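import Summits.PneNP.PneNP.Theorems.ExpanderLinearGeneratorsLinearGeneratorModPFregeHardCalibration
import HarnessLib

/-!
# `MOD₂` summation, abstract level, IV: from the refuted context to a Frege proof of
`¬H₁ ∨ ⋯ ∨ ¬H_N ∨ ¬ofCNF φ`

Support file for item `stmt-PneNP-11444` (`LinearGeneratorModPFregeHard`), calibration line "for
`p = 2` the rung fails".  The files `…Mod2Xor/RowWalk/Row/Chain.lean` derive, in the sequent
toolkit `DepthFrege.Sq`, the context `K = (¬C)_{C ∈ φ} ++ (¬H)_{H ∈ HL}` itself (the negated
clauses of the CNF `φ` and the negated skeleton hypotheses).  This file closes the abstract level: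

* `sq_foldClauses` — the negated clauses are folded into the single member `¬ ofCNF φ`
  (iterated `¬∧`-rule along `ofCNF φ = C₁ ∧ (C₂ ∧ ⋯ (C_M ∧ ⊤))`);
* `exists_derivation_of_sq_context` — then the negated hypotheses and `¬ ofCNF φ` are folded into
  one right-nested disjunction `G = ¬H₁ ∨ (⋯ (¬H_N ∨ ¬ofCNF φ))` (`Sq.foldOr`) and a
  hypothesis-free `textbookFrege` derivation of `G` is extracted (`Sq.extract`), with its depth
  (`≤ D + 26`) and symbol-size bound — the input expected by
  `exists_isModDepthProofOf_of_derivation` (`…Mod2Transfer.lean`).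

No definitions are introduced.

Sources: J. R. Shoenfield, *Mathematical Logic* (1967), §3.1; the bookkeeping of
`DepthFregeSequents.lean` / `RamseyTautologiesProofs.lean` (`Sq.extract`); folklore.
-/

set_option linter.dupNamespace false -- `Summit.PneNP.PneNP.…`: summit = sub-problem (D-0017)

namespace Summit.PneNP.PneNP.Theorems.ModTwo

open Literature.Computability.Complexity Literature.Computability.Complexity.PropForm
open Literature.Computability.MetaComplexity Literature.Computability.MetaComplexity.DepthFrege
open Literature.Computability.MetaComplexity.TextbookFrege (disjList disjList_nil disjList_cons)
open Literature.Computability.MetaComplexity.KEval (litForm clauseForm clauseForm_cons ofCNF_cons)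

section Fold

variable {Q : SPrm}

/-- **Folding the negated clauses.** From `⊢ ¬C₁, …, ¬C_M, R` infer `⊢ ¬ofCNF [C₁,…,C_M], R`
(`3M + 1` ticks: reorder, recurse, `¬∧`). [Shoenfield 1967, §3.1] [folklore] -/
theorem sq_foldClauses {R : List (PropForm ℕ)} :
    ∀ (φ : CNF ℕ) {t : ℕ}, Sq Q t ((φ.map fun C => neg (clauseForm C)) ++ R) →
      Base Q (neg (PropForm.ofCNF φ)) → φ.length + R.length + 2 ≤ Q.W →
      Sq Q (t + 3 * φ.length + 1) (neg (PropForm.ofCNF φ) :: R)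
  | [], t, h, hb, hW => by
    simp only [List.map_nil, List.nil_append] at h
    refine (h.weaken (fun A hA => List.mem_cons_of_mem _ hA) ?_ ?_).mono (by simp)
    · intro A hA
      rcases List.mem_cons.1 hA with rfl | hA
      · exact hb
      · exact h.base A hA
    · simp only [List.length_cons]; simp at hW; omega
  | C :: φ, t, h, hb, hW => by
    rw [ofCNF_cons] at hb ⊢
    simp only [List.map_cons, List.cons_append, List.length_cons] at h hW
    have hbC : Base Q (neg (clauseForm C)) := hb.neg_of_negConj_left
    have hbφ : Base Q (neg (PropForm.ofCNF φ)) := hb.neg_of_negConj_right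
    -- move `¬C` behind the remaining clauses
    have h1 : Sq Q (t + 1) ((φ.map fun C => neg (clauseForm C)) ++ (neg (clauseForm C) :: R)) :=
      h.weaken (by intro A hA; simp only [List.mem_cons, List.mem_append] at hA ⊢; tauto)
        (by
          intro A hA
          simp only [List.mem_append, List.mem_cons] at hA
          rcases hA with hA | rfl | hA
          · exact h.base A (by simp [hA])
          · exact hbC
          · exact h.base A (by simp [hA]))
        (by simp only [List.length_append, List.length_map, List.length_cons]; omega)
    have h2 := sq_foldClauses φ h1 hbφ (by simp only [List.length_cons]; omega)
    -- swap and close the conjunction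
    have h3 : Sq Q (t + 1 + 3 * φ.length + 1 + 1)
        (neg (clauseForm C) :: neg (PropForm.ofCNF φ) :: R) :=
      h2.weaken (by intro A hA; simp only [List.mem_cons] at hA ⊢; tauto)
        (by
          intro A hA
          simp only [List.mem_cons] at hA
          rcases hA with rfl | rfl | hA
          · exact hbC
          · exact hbφ
          · exact h.base A (by simp [hA]))
        (by simp; omega)
    exact (Sq.consNegConj h3 hb).mono (by simp only [List.length_cons]; omega)

/-- Base-ness is inherited by the tail of a right-nested disjunction. [folklore] -/
theorem base_foldr_tail (X : PropForm ℕ) :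
    ∀ HL : List (PropForm ℕ), Base Q (HL.foldr (fun H R => disj (neg H) R) X) → Base Q X
  | [], h => h
  | _ :: HL, h => base_foldr_tail X HL (by rw [List.foldr_cons] at h; exact h.of_disj_right)

/-- **From the refuted context to a derivation of `G`.** If the context
`(¬C)_{C ∈ φ} ++ (¬H)_{H ∈ HL}` is `Sq`-derivable in `t` ticks and
`G = ¬H₁ ∨ (⋯ (¬H_N ∨ ¬ofCNF φ))` is a base formula, then `G` has a hypothesis-free
`textbookFrege`-derivation containing it, all of whose lines have depth `≤ D + 26`, of total symbol
size `≤ ((t + 3|φ| + 3N + 4)·κ + 8) · Λ · (M + 14)`. [Shoenfield 1967, §3.1] [folklore] -/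
theorem exists_derivation_of_sq_context {φ : CNF ℕ} {HL : List (PropForm ℕ)} {t : ℕ}
    (h : Sq Q t ((φ.map fun C => neg (clauseForm C)) ++ HL.map neg))
    (hG : Base Q (HL.foldr (fun H R => disj (neg H) R) (neg (PropForm.ofCNF φ))))
    (hW : φ.length + HL.length + 3 ≤ Q.W) :
    ∃ π₀ : List (PropForm ℕ), textbookFrege.IsDerivation ∅ π₀ ∧
      HL.foldr (fun H R => disj (neg H) R) (neg (PropForm.ofCNF φ)) ∈ π₀ ∧
      (∀ ψ ∈ π₀, ψ.altDepth ≤ Q.D + 26) ∧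
      proofSize π₀ ≤ ((t + 3 * φ.length + 3 * HL.length + 4) * κ Q + 8) * (Q.Λ * (Q.M + 14)) := by
  have hbΦ : Base Q (neg (PropForm.ofCNF φ)) := base_foldr_tail _ HL hG
  have h1 := sq_foldClauses φ h hbΦ (by simp at hW ⊢; omega)
  -- reorder: hypotheses first, `¬ofCNF φ` last
  have h2 : Sq Q (t + 3 * φ.length + 1 + 1) ([] ++ HL.map neg ++ neg (PropForm.ofCNF φ) :: []) :=
    h1.weaken (by intro A hA; simp only [List.mem_cons, List.mem_append, List.nil_append] at hA ⊢;
                  tauto)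
      (by
        intro A hA
        simp only [List.nil_append, List.mem_append, List.mem_singleton] at hA
        rcases hA with hA | rfl
        · exact h1.base A (List.mem_cons_of_mem _ hA)
        · exact hbΦ)
      (by simp; omega)
  have hfold : (HL.map neg).foldr disj (neg (PropForm.ofCNF φ)) =
      HL.foldr (fun H R => disj (neg H) R) (neg (PropForm.ofCNF φ)) := by
    rw [List.foldr_map]
  have h3 := Sq.foldOr (HL.map neg) h2 (by rw [hfold]; exact hG)
  rw [List.nil_append, hfold] at h3
  obtain ⟨π, ⟨⟨hder, hlast⟩, hdepth⟩, hsize⟩ := Sq.extract h3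
  refine ⟨π, hder, List.mem_of_getLast? hlast, hdepth, hsize.trans ?_⟩
  refine Nat.mul_le_mul_right _ (Nat.add_le_add_right (Nat.mul_le_mul_right _ ?_) _)
  simp only [List.length_map]
  omega

end Fold

end Summit.PneNP.PneNP.Theorems.ModTwo
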